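import Mathlib
import HarnessLib
import HarnessLib.Audit
import Summits.KontsevichZagierPeriods.Statement
import Literature.NumberTheory.Transcendental.SemialgebraicMapsProofs

/-!
Route: AyoubSpecialisation

DORMANT since 2026-09-04T21:45:54Z (reconciler: no traction for 5 d (last activity item-evidence-added at 2026-08-30T20:47:30Z); parked, not closed — `ledger route dormant route-KontsevichZagierPeriods-AyoubSpecialisation --off` to reac) — unstaffed, not closed; items shared with open routes are served there. `ledger route dormant <id> --off` reactivates.

# Route AyoubSpecialisation — π-localisation — Conjecture 1 = (the kernel conjecture with [π]
inverted) + ([π] is a non-zero-divisor on FormalRep ⧸ relations)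

It suffices to show X = PiLocalKernel ∧ PiCancellation for KZ's calculus of moves (the pivot of
2026-08-13, recorded as the route's
thesis by this repair; the survey thesis "lift to Ayoub's relative periods" is retired, see Why this
line). Fix the disc representation
[π] = [{x² + y² ≤ 1}, 1] (value π, `Literature.NumberTheory.Transcendental.KZ.piRep_value`) and the
product [π] ⋆ r (disc in the two
leading coordinates, r in the trailing n). X1 = PiLocalKernel (crux 3, `AyoubPiLocalKernel`): every
formal ℤ-combination c of integral
representations with eval c = 0 satisfies [π]^{⋆N} ⋆ c ∈ KZ.relations for some N — Conjecture 1 for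
the LOCALISED effective period ring,
the form every structural method in print addresses. X2 = PiCancellation (crux 2,
`AyoubPiCancellation`): [π] ⋆ c ∈ relations → c ∈
relations — [π] is a non-zero-divisor on FormalRep ⧸ relations; transcendence-free, the
effective-versus-localised seam. The items type
the product through an interface (P n r : IntegralRep (n+2) pinned by its domain and integrand;
∀-form in the two cruxes, ∃-form = the
support item `PiProductRep`, whose witness is `KZ.piRep.prod r` transported from Fin (2+n) to Fin
(n+2)); the target `AyoubThesisV2` is
the bundled ∃-form; the closed-term forms are
`Literature.NumberTheory.Transcendental.KZ.PiLocalKernel` /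
`Literature.NumberTheory.Transcendental.KZ.PiCancellation` (KZProduct.lean, def wi-04087,
deliberately not imported). No idea card (survey route).
Lean: `PiProductRep ∧ AyoubPiLocalKernel ∧ AyoubPiCancellation`

Rationale: WHY THIS LINE. Kontsevich–Zagier pose Conjecture 1 for EFFECTIVE periods, but every structural
result in print inverts 2πi first: KontsevichZagier2001
§4.1 works in P̂ = P[(2πi)⁻¹]; the Nori/Kontsevich formal period algebra is that localisation
(HuberMullerStachPeriods2017 Def. 12.1.1,
§13.1; arXiv:1105.0865 Def. 2.8, torsor Thm. 2); Ayoub's relative period theorem holds only over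
D((2πi)⁻¹) (AyoubRelKZRevisited
Rem. 1.3, Thm. 1.11; Ayoub2014 Def. 6 / Conj. 7), and HuberWustholz2022 App. A.4 (p. 200) print the
injectivity
P̃(MM^eff_Nori) → P̃(MM_Nori) as an open question. The line splits S (ker eval = relations) along
the element [π] into the localised
statement X1, where torsor / motivic-Galois methods can in principle act, and the regular-element
statement X2, which constrains no
value of any period; S ⟹ X1 ∧ X2 given soundness (KZProduct
`piLocalKernel_and_piCancellation_of_kernel`) and X1 ∧ X2 ⟹ S ⟹ the
KZ-literal statement (Theorems/AyoubSpecialisationAssembly.lean,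
Theorems/KernelFormKernelImpliesStatement.lean; the deciding theorem
`closes` re-proves both inline so that no item names the open conjecture constant). Imported areas:
commutative algebra of the presented
ring FormalRep ⧸ relations (regular elements, localisation) and the motivic period formalism as the
guide for X1; Ayoub's rigid-analytic
relative theorem survives only as the calibration item `AyoubRelACubeCalibration`. The survey thesis
(Lifting ∧ RelativeTransfer over
Ayoub's relative periods) died with def wi-03779 / p3107: the Annals theorem over ℚ̄ is open by the
author's erratum (AyoubRelKZRevisited
Rem. 1.3) and the relative generators f·L with ∫f = 0 already carry S, so Lifting ≡ S; its informal
leftovers (0360 AyoubThesis, 0362 AyoubLifting, 0363 AyoubRelativeTransfer; no Lean statement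
possible short of S, wanted by this route only) await an OPERATOR drop — planner drops bounce on
route.multi-assembly (2026-08-15 and again 2026-08-16, gen 3).

RANKED CRUXES. #0 AyoubThesisV2 (target) — X in bundled form: there is a pinned product P (P n r =
[π] ⋆ r : IntegralRep (n+2)) such that every c with eval c = 0 has (P-multiplication)^[N] c ∈
KZ.relations for some N, and P-multiplication reflects membership in KZ.relations. (why it might
fail: Equivalent to the kernel conjecture S given soundness and PiProductRep, so it fails exactly
when Conjecture 1 fails — e.g. on any π-division witness (AyoubNotPiCancellation).)
[KontsevichZagier2001, Ayoub2014, HuberMullerStachPeriods2017]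
#2 AyoubPiCancellation (crux) — π-cancellation: for every pinned product P (P n r = [π] ⋆ r, disc in
the two leading coordinates) and every formal combination c, if [π] ⋆ c ∈ KZ.relations then c ∈
KZ.relations — [π] is a non-zero-divisor on FormalRep ⧸ relations (the route's distinctive,
transcendence-free statement). [deps: PiProductRep] [difficulty: open-problem] (why it might fail: A
certificate for [π]·c may use changes of variables mixing the two disc coordinates with c's, leaving
no shadow certificate for c; the motivic shadow (P̃(MM^eff_Nori) → P̃(MM_Nori) injective) is printed
as OPEN (HuberWustholz2022 App. A.4); one witness c refutes the summit.) [HuberWustholz2022,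
AyoubRelKZRevisited, KontsevichZagier2001, HuberMullerStachPeriods2017]
#3 AyoubPiLocalKernel (crux) — π-local kernel: for every pinned product P and every formal
combination c with eval c = 0 there is N with (P-multiplication)^[N] c ∈ KZ.relations — Conjecture 1
for the effective period ring localised at [π] (Ayoub2014 Conj. 7 transcribed to the four moves,
ℤ-coefficients, the real period [π] for 2πi). [deps: PiProductRep] [difficulty: open-problem] (why
it might fail: Period-conjecture strength (Ayoub2014 Cor. 32, HMS Prop. 13.2.6): with PiCancellation
it yields algebraic independence of ζ(3), ζ(5), …; torsor methods give relations in Nori's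
presentation only, and their transfer into the four moves (even with [π] inverted) is unproved.)
[Ayoub2014, HuberMullerStachPeriods2017, arXiv:1105.0865, AyoubRelKZRevisited, arXiv:1811.06268]
#9 PiProductRep (support) — the pinned product exists: a family P n r : IntegralRep (n+2) with
domain {z | z₀² + z₁² ≤ 1 ∧ (z₂,…,z_{n+1}) ∈ r.domain} and integrand z ↦ r.integrand (z₂,…,z_{n+1})
— i.e. [π] ⋆ r; construction = transport of `Literature.NumberTheory.Transcendental.KZ.piRep.prod r
: IntegralRep (2 + n)` along Fin (2+n) ≃ Fin (n+2) (semialgebraicity of domain/integrand by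
`IsSemialgebraic.preimage_aeval` under the coordinate relabelling, no Tarski–Seidenberg;
integrability by `KZ.IntegralRep.integrableOn_prodFun` and
`MeasureTheory.volume_measurePreserving_piCongrLeft`), or directly by Tonelli. Index bookkeeping
only; it makes the ∀-pinned-P cruxes non-vacuous. Since the crux-only ruling (2026-08-16) it is NOT
a hypothesis of `closes` (rev 10): the deciding theorem proves it INLINE (domain = polynomial
inequality ∩ coordinate preimage, `IsSemialgebraic.preimage_comp`; integrand via
`isSemialgebraicFunOn_iff` + `preimage_comp`, no Tarski–Seidenberg; integrability by two Tonelli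
steps along `MeasurableEquiv.piFinSuccAbove` (volume-preserving) and `IntegrableOn.mono_set` from
the box [−1,1]² × σ to the disc cylinder). As an item it stays claimable by anyone idle — a Theorems
file may copy the ≈ 85-line script out of `closes`. [difficulty: provable-now]
[KontsevichZagier2001, BCR1998]
#9 AyoubNotPiCancellation (support) — kill switch ¬PiCancellation: some pinned P and some c have [π]
⋆ c ∈ KZ.relations but c ∉ KZ.relations; with soundness
(`Literature.NumberTheory.Transcendental.KZ.relations_le_ker_eval`, in tree) such a c has eval c =
0, so it refutes S and the summit (negative side, staffed as support; no witness is claimed).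
[difficulty: open-problem] [HuberWustholz2022, KontsevichZagier2001, AyoubRelKZRevisited]
#9 AyoubRelACubeCalibration (support) — calibration against Ayoub's cube presentation: for a
ℚ-semialgebraic C¹ function G near [0,1]^m and any coordinate i, the cube representation with
integrand ∂G/∂zᵢ − G|_{zᵢ=1} + G|_{zᵢ=0} (Ayoub's generator (a),
`Literature.NumberTheory.Transcendental.AyoubRel.relA`) lies in KZ.relations — derivable by the four
moves for every coordinate, not only the last (coordinate transposition + Newton–Leibniz +
re-inflation of the restriction terms + integrand additivity); the Tarski–Seidenberg antecedents are
discharged in tree (`add_holds`, `mul_holds`). [difficulty: M] [AyoubRelKZRevisited, Ayoub2014,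
KontsevichZagier2001]
#9 TargetGlue (support) — glue to the rank-0 target (route-choice repair 2026-08-16, gate shape
route.target-unreachable, option (a); item stmt-KontsevichZagierPeriods-14210): PiProductRep →
AyoubPiCancellation → AyoubPiLocalKernel → AyoubThesisV2 — the pinned product and the two cruxes
give the bundled target; pure logic (`intro hP h₂ h₃; obtain ⟨P, hPin⟩ := hP; exact ⟨P, hPin, h₃ P
hPin, h₂ P hPin⟩`), provable now (planner Sketch.lean rc 0, 0 sorries, axioms
propext/Classical.choice/Quot.sound). It gives the target an item that concludes it BY NAME and
records its logical position: modulo PiProductRep the target is exactly the conjunction consumed by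
the deciding theorem `closes` (converse AyoubThesisV2 → PiProductRep and AyoubThesisV2 → the
Statement by the script of `closes`, also checked in Sketch.lean); it carries no mathematical risk
and changes nothing in `closes`. [deps: PiProductRep, AyoubPiCancellation, AyoubPiLocalKernel]
[difficulty: provable-now] [KontsevichZagier2001, HuberMullerStachPeriods2017]
Assembly (item Assembly 0361 := PiProductRep → AyoubPiCancellation → AyoubPiLocalKernel →
KontsevichZagierPeriods; since rev 10 its first antecedent is redundant — the 1:1 restate to the
type of `closes` and the removal of the second assembly-kind item Assembly2 0539 (the pre-glue
bundled form X → kernel form) are refused to planners while two assembly items exist (gate: assembly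
items can be neither dropped nor retriaged, and every other drop/restate bounces on
route.multi-assembly) — OPERATOR action requested 2026-08-15 16:50Z, 18:11Z and by the gen-3 repair
2026-08-16): two elementary steps plus logic, all inside the crux-only deciding theorem `closes (h₂
: AyoubPiCancellation) (h₃ : AyoubPiLocalKernel) : KontsevichZagierPeriods` (rev 10, glue_ok, native
h21_check_closes ok, axioms propext / Classical.choice / Quot.sound, hypotheses exactly the two
cruxes in rank order): construct the pinned P inline (the PiProductRep script above, then `choose`);
for c with eval c = 0, h₃ gives N with (P·)^[N] c ∈ relations and induction on N peels one [π] at a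
time with h₂ (powers are left-nested iterates, so no associativity of ⋆ is needed), giving the
kernel form ∀ c, eval c = 0 → c ∈ relations (stated by its definiens, never by the name of the open
conjecture constant); for rational r, r' with equal value, eval ([r] − [r']) = 0 by `KZ.eval_of`,
hence [r] − [r'] ∈ relations = KZ.Equivalent r r'. The target AyoubThesisV2 is ⟨P, hPin, h₃ P hPin,
h₂ P hPin⟩ — filed as the support item TargetGlue (cruxes → target, 2026-08-16) — and is not a
hypothesis of `closes`.

TWO-LAYER PLAN. Foreseen only, nothing filed: AyoubPiCancellation ⇐ (RelationsIdeal: KZ.relations is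
a two-sided ideal under ⋆, the named facts
`KZ.mul_mem_relations_left/right`) → (FibreSpecialisation: a certificate for [π] ⋆ c restricts to
the fibre over a rational point of the
disc and descends by domain additivity) → AyoubPiCancellation; AyoubPiLocalKernel ⇐ (torsor
injectivity with [π] inverted, shared with
route Grothendieck) → (transfer of cohomological relators into the four moves, shared with route
VeryGoodTransfer) → AyoubPiLocalKernel.

KILL CRITERIA. A proof of AyoubNotPiCancellation (= ¬AyoubPiCancellation, item 0542) closes the
route `refuted:AyoubPiCancellation` AND, with soundness
(`KZ.relations_le_ker_eval`, in tree), refutes the summit itself (eval c = 0, c ∉ relations) — hand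
the witness to route Neg. A refutation
of AyoubPiLocalKernel likewise refutes S (it follows from S with N = 0). A proof of the kernel
conjecture by any other route moots this
one (both cruxes follow: KZProduct `piLocalKernel_of_kernel`, `piCancellation_of_kernel`).
PiProductRep cannot fail mathematically; if
its TYPING is found wrong (index convention), restate it together with the shared antecedent of the
two cruxes.

NOT DECOMPOSED YET. Everything below the two cruxes: the ideal property of KZ.relations under ⋆
(named facts `KZ.mul_mem_relations_left/right` in
KZProduct.lean, unproved, deliberately NOT imported so the cone stays clean), normal forms for
certificates of [π] ⋆ c, the small cases
(c supported in dimension ≤ 1, where Neg/LowDimension data exist), and the identification of the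
interface P with `KZ.piRep.prod`
beyond existence (uniqueness of pinned P is structure-eta + proof irrelevance). No split until a
crux moves (D-0019).

CHEAPEST FALSIFIER. For crux 2: take the classical identities proved by "multiply by π and divide
back" — Euler's 6·[∫∫_{[0,1]²} dxdy/(1−xy)] versus [π] ⋆ [π],
and Legendre's relation (right side π/2) — and ask whether the in-tree additive move invariants
(`Literature.Barriers.KontsevichZagierPeriods.not_kz_of_moveInvariant_separating` machinery)
separate some c from relations while an
explicit certificate puts [π] ⋆ c in relations; one such c kills crux 2 and the summit. Not runnable
by kit (certificate search in the
move calculus is not implemented); recorded for refuters. For the line as a whole nothing is cheaper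
than refuting S.

NUMBERS. value [π] = π (`KZ.piRep_value`); eval ([π] ⋆ c) = π · eval c unconditionally
(`KZ.eval_piRep_mul`). Items: 13 ledger rows — 9 load-bearing (target 0538; cruxes 0540 rank 2, 0541
rank 3; supports 0197 closed-proved, 0542, 0543, 10941, 14210; assembly 0361) + 4 awaiting operator
removal (informal 0360/0362/0363, second assembly 0539). Groundings on 0540/0541: five groundings +
refuter check + reground 2026-08-14, no printed theorem or counterexample either way. CONE
(route-repair gen 3, 2026-08-16; needs-fact: NONE): gate decl cone 0 unproved (31 project constants
at rev 9; `closes` rev 10 adds only proved Mathlib measure theory and the proved SemialgebraicMaps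
lemmas `IsSemialgebraic.preimage_comp` / `setOf_init_mem` / `isSemialgebraicFunOn_iff` /
`isSemialgebraic_setOf_eval_le`), staffable, READY. The two module-cone census entries
`Literature.NumberTheory.Transcendental.KZKernelConjecture` and `…KZPeriodConjecture'`
(PeriodConjecture.lean, XL, [status: open]) are the kernel form and the all-semialgebraic form of
the SUMMIT ITSELF, proved equivalent to it in KZKernelConjectureForms.lean
(`kzKernelConjecture_iff_isRational`, `kzPeriodConjecture'_iff_isRational`); they reach this module
only through the operator-owned sub Statement.lean `import
Literature.NumberTheory.Transcendental.PeriodConjecture` shared by every route of the summit (the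
Statement body is typed over KZCalculus alone), are named by no item and not by `closes` (which
states the kernel form by its definiens) — so they are NOT needs-fact (filing them would file the
summit as its own tier-0 debt) and cannot be re-routed around by a planner; the route's single own
import (SemialgebraicMapsProofs, a discharge file over TarskiSeidenbergProofs) is fact-free.
Operator lever (same finding as the gen-1 repairs of AbelContraction / TwoRouteTransport): drop the
unused PeriodConjecture / ComputableReal imports from
Summits/KontsevichZagierPeriods/KontsevichZagierPeriods/Statement.lean, or let the module census
skip [status: open] statement-equivalent constants as the gate's decl cone already does.

DEFINITION REQUESTS. None open: wi-04087 landed as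
Literature/NumberTheory/Transcendental/KZProduct.lean (piRep, IntegralRep.prod, FormalRep.mul,
PiCancellation, PiLocalKernel); wi-03779 (Ayoub relative periods) landed as AyoubRelative*.lean with
the erratum recorded. The route keeps
the interface typing of 0538–0542 (stamped) rather than re-filing them over the landed closed terms.

Novelty: Searches (2026-08-15, this repair): `lit search --hybrid --source local "effective periods
localization 2πi injective Kontsevich-Zagier
period conjecture"` (8 docs; top hit book:huber2022-transcendence-linear-relations-1-periods pp.
10–11, 222, 232 — same source as below;
rest off-topic); remote cascade: `lit search --source all …` rc 75 at 16:25Z (searchd unavailable),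
OpenAlex / Semantic Scholar HTTP 429 at 16:45Z, arXiv API 0 rows, `lit search --source zbmath
"Kontsevich-Zagier period conjecture" --year-from 2020` (3: arXiv:2507.15020 p-adic 1-motives,
doi:10.5802/jtnb.1204 = CressonViuSos2022, doi:10.1142/s179304212150007x = Viu-Sos semi-canonical
reduction — all already cited in tree); `lit galaxy search "formal effective periods" --star all`
(1: pdf:-1872635349266679900, the HMS Part III draft, held).
Searches (2026-08-15, retriage unit): `lit frontier KontsevichZagierPeriods --since 2020` (30 rows;
nearest arXiv:2303.05030, GPC for CM
Kummer surfaces; nothing on effective vs localised formal periods); `lit bridges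
KontsevichZagierPeriods --cross any` (30 rows, none
relevant); `lit search --source zbmath "period conjecture Kontsevich Zagier"` (9: zbl:1039.11002,
doi:10.4007/annals.2015.181.3.2,
arXiv:2507.15020, doi:10.1017/9781009019729, arXiv:1912.01751, arXiv:1509.01097, …), `"formal
periods Nori motives torsor"` (1:
arXiv:1105.0865), `"effective periods motives"` (11: doi:10.1007/978-3-319-50926-6,
arXiv:2505.20397, arXiv:0805.2569, …); `lit search
--hybrid --source  [refs: 10.5802/jtnb.1204, 10.1142/s179304212150007x, 10.4007/annals.2015.181.3.2, 10.1017/9781009019729, 10.1007/978-3-319-50926-6, 2507.15020, 2303.05030, 1912.01751, 1509.01097, 1105.0865, 2505.20397, 0805.2569, 1811.06268, book:huber2022-transcendence-linear-relations-1-periods, doi:10.5802/jtnb.1204, doi:10.1142/s179304212150007x, doi:10.4007/annals.2015.181.3.2, doi:10.1017/9781009019729, doi:10.100]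

Barriers (technique_class: localisation-at-pi, regular-element, motivic-torsor): - technique_class: localisation-at-pi, regular-element, motivic-torsor
- Literature.Barriers.KontsevichZagierPeriods.kzConjecture_implies_oddZetaAlgIndep: conceded for
AyoubPiLocalKernel — with PiCancellation it is S, so it inherits period-conjecture strength (that is
why it is rank 3, not 2, and why its splits belong to the torsor routes); EVADED by
AyoubPiCancellation, which asserts no identity between values at all: it is a regular-element
property of the presented ring FormalRep ⧸ relations, implied by S but implying no
algebraic-independence statement.
- Literature.Barriers.KontsevichZagierPeriods.kzConjecture_implies_twoPiI_log_algIndep: same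
division — conceded for AyoubPiLocalKernel, not engaged by AyoubPiCancellation /
AyoubNotPiCancellation (no value of any period is constrained by them beyond eval c = 0 ⇒ eval
([π]·c) = 0).
- Literature.Barriers.KontsevichZagierPeriods.kzConjecture_implies_ellipticPeriods_algIndep: same
division; no elliptic period is singled out by the route.
- Literature.Barriers.KontsevichZagierPeriods.noSemialgebraicPrimitive_inv_sub_two (Lean decl
…KontsevichZagierPeriods.KZ.noSemialgebraicPrimitive_inv_sub_two): not engaged — no variable is
integrated out and no new primitive is posited; the only primitives foreseen are g ⊗ F for existing
Newton–Leibniz certificates F times the disc factor (KZProductIdeal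
`of_mul_mem_relations_of_mem_newtonLeibnizRel`), which stay ℚ-semialgebraic (Tarski–Seidenberg,
proved in tree: `mul_holds`).
- Literature.

History (route lifecycle, newest last):
- 2026-08-16T14:43:05Z · LINT AUTOFIX route.multi-assembly: kept Assembly, dropped Assembly2 (gate:hygiene)
- 2026-08-23T21:50:35Z · DORMANT — reconciler: no traction for 6.3 d (last activity item-evidence-added at 2026-08-17T14:41:05Z); parked, not closed — `ledger route dormant route-KontsevichZagier (operator:999:560210)
- 2026-08-30T03:35:31Z · REACTIVATED — reconciler: reactivated — activity statement-attached at 2026-08-30T02:51:58Z after parking at 2026-08-23T21:50:35Z (operator:999:3921642)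
- 2026-09-04T21:45:54Z · DORMANT — reconciler: no traction for 5 d (last activity item-evidence-added at 2026-08-30T20:47:30Z); parked, not closed — `ledger route dormant route-KontsevichZagierPe (operator:999:4165879)

sub-problem: KontsevichZagierPeriods · status: dormant · opened planner-KontsevichZagierPeriods-Survey-0 2026-08-13T06:11:09Z · rev 12 · ledger route-KontsevichZagierPeriods-AyoubSpecialisation
GENERATED by the gate from the ledger (D-0016/17). Provers cite these decls: `theorem foo : Summit.KontsevichZagierPeriods.KontsevichZagierPeriods.Theses.AyoubSpecialisation.<Decl> := …` in Summits/KontsevichZagierPeriods/KontsevichZagierPeriods/Theorems/<Name>.lean.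
-/

namespace Summit.KontsevichZagierPeriods.KontsevichZagierPeriods.Theses.AyoubSpecialisation

open scoped BigOperators Topology Manifold Classical MeasureTheory ProbabilityTheory Matrix InnerProductSpace ComplexConjugate ContinuousMap
open Filter Set Function TopologicalSpace MeasureTheory

attribute [summit_statement] _root_.KontsevichZagierPeriods

open Literature Periods

/-- item stmt-KontsevichZagierPeriods-0538 · target · rank 0 · open · by planner
why it might fail: Equivalent to the kernel conjecture S given soundness and PiProductRep, so it fails exactly when Conjecture 1 fails — e.g. on any π-division witness (AyoubNotPiCancellation).
sources: KontsevichZagier2001, Ayoub2014, HuberMullerStachPeriods2017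
PIVOT 2026-08-13 (session 105). The route's fact hypothesis died: def wi-03779 closed with p3107
vendoring AyoubRelKZRevisited Thm 1.7 and the author's erratum (Rem 1.3: Annals Thm 4.25 over ℚ̄ is
open, proved only when π is algebraic over k); moreover Thm 1.1/1.11's generators (b) f·L with ∫f =
0 include f·1, so the relative theorems carry no absolute content and old Lifting 0362 ≡ S, old
Transfer 0363 clause (b) ≡ S. New thesis keeps Ayoub's failure MECHANISM (torsor exists only after
inverting 2πi) and splits S along it. Fix piRep : IntegralRep 2 (closed unit disc, integrand 1;
value π) and the product ⋆ of representations extended bilinearly to FormalRep. X′ := PiLocalKernel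
∧ PiCancellation where PiLocalKernel := ∀ c : Literature.NumberTheory.Transcendental.KZ.FormalRep,
Literature.NumberTheory.Transcendental.KZ.eval c = 0 → ∃ N, piRep^⋆N ⋆ c ∈
Literature.NumberTheory.Transcendental.KZ.relations; PiCancellation := ∀ c, piRep ⋆ c ∈
Literature.NumberTheory.Transcendental.KZ.relations → c ∈
Literature.NumberTheory.Transcendental.KZ.relations. Target Lean shape once the def lands:
`Literature.NumberTheory.Transcendental.KZ.PiLocalKernel ∧
Literature.NumberTheory.Transcendental.KZ. -/
@[route_item "route-KontsevichZagierPeriods-AyoubSpecialisation"]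
def AyoubThesisV2 : Prop :=
  ∃ (P : ∀ n : ℕ, Literature.NumberTheory.Transcendental.KZ.IntegralRep n → Literature.NumberTheory.Transcendental.KZ.IntegralRep (n + 2)), (∀ (n : ℕ) (r : Literature.NumberTheory.Transcendental.KZ.IntegralRep n), (P n r).domain = {z : Fin (n + 2) → ℝ | z 0 ^ 2 + z 1 ^ 2 ≤ 1 ∧ (fun i : Fin n => z i.succ.succ) ∈ r.domain} ∧ (P n r).integrand = fun z => r.integrand (fun i : Fin n => z i.succ.succ)) ∧ (∀ c : Literature.NumberTheory.Transcendental.KZ.FormalRep, Literature.NumberTheory.Transcendental.KZ.eval c = 0 → ∃ N : ℕ, (⇑(FreeAbelianGroup.lift (fun s : (Σ n, Literature.NumberTheory.Transcendental.KZ.IntegralRep n) => Literature.NumberTheory.Transcendental.KZ.of (P s.1 s.2))))^[N] c ∈ Literature.NumberTheory.Transcendental.KZ.relations) ∧ (∀ c : Literature.NumberTheory.Transcendental.KZ.FormalRep, FreeAbelianGroup.lift (fun s : (Σ n, Literature.NumberTheory.Transcendental.KZ.IntegralRep n) => Literature.NumberTheory.Transcendental.KZ.of (P s.1 s.2)) c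 ∈ Literature.NumberTheory.Transcendental.KZ.relations → c ∈ Literature.NumberTheory.Transcendental.KZ.relations)

/-- item stmt-KontsevichZagierPeriods-0540 · crux · rank 2 · open · by planner
why it might fail: A certificate for [π]⋆c may use changes of variables mixing the two disc coordinates with c's, leaving no shadow certificate for c; the motivic shadow (P̃(MM^eff_Nori) → P̃(MM_Nori) injective) is printed as OPEN (HuberWustholz2022 App. A.4); one witness c refutes the summit.
sources: HuberWustholz2022, AyoubRelKZRevisited, KontsevichZagier2001, HuberMullerStachPeriods2017
PiCancellation := ∀ c : Literature.NumberTheory.Transcendental.KZ.FormalRep, (of piRep) ⋆ c ∈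
Literature.NumberTheory.Transcendental.KZ.relations → c ∈
Literature.NumberTheory.Transcendental.KZ.relations, piRep = closed unit disc with integrand 1 (d =
2). A consequence of S (eval (piRep ⋆ c) = π · eval c by Fubini, π ≠ 0), but transcendence-free: it
is a regular-element property of the presented abelian group FormalRep/relations under the product,
and the exact point where Ayoub's relative theorem fails to be effective (AyoubRelKZRevisited Rem
1.3: the torsor exists only over D((2πi)⁻¹)) and where HuberMullerStach2017 §13 passes from P^eff to
P = P^eff[(2πi)⁻¹]. Independent of the chosen π-representation once `relations` is an ideal under ⋆
(part of the def request). Attack suggestions: (i) normal forms for ⋆-multiples of disc reps (the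
disc factor occupies two leading coordinates untouched by NL along the last coordinate; CoV may mix
them — the crux is whether a relation certificate for piRep ⋆ c can be 'projected' to one for c,
e.g. by restricting/fibrewise-specialising the disc coordinates at a rational point and using domain
additivity); (ii) small cases: c supported in dimensi -/
@[route_item "route-KontsevichZagierPeriods-AyoubSpecialisation"]
def AyoubPiCancellation : Prop :=
  ∀ (P : ∀ n : ℕ, Literature.NumberTheory.Transcendental.KZ.IntegralRep n → Literature.NumberTheory.Transcendental.KZ.IntegralRep (n + 2)), (∀ (n : ℕ) (r : Literature.NumberTheory.Transcendental.KZ.IntegralRep n), (P n r).domain = {z : Fin (n + 2) → ℝ | z 0 ^ 2 + z 1 ^ 2 ≤ 1 ∧ (fun i : Fin n => z i.succ.succ) ∈ r.domain} ∧ (P n r).integrand = fun z => r.integrand (fun i : Fin n => z i.succ.succ)) → ∀ c : Literature.NumberTheory.Transcendental.KZ.FormalRep, FreeAbelianGroup.lift (fun s : (Σ n, Literature.NumberTheory.Transcendental.KZ.IntegralRep n) => Literature.NumberTheory.Transcendental.KZ.of (P s.1 s.2)) c ∈ Literature.NumberTheory.Transcendental.KZ.relations → c ∈ Literature.NumberT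heory.Transcendental.KZ.relations

/-- item stmt-KontsevichZagierPeriods-0541 · crux · rank 3 · open · by planner
why it might fail: Period-conjecture strength (Ayoub2014 Cor. 32, HMS Prop. 13.2.6): with PiCancellation it yields algebraic independence of ζ(3), ζ(5), …; torsor methods give relations in Nori's presentation only, and their transfer into the four moves (even with [π] inverted) is unproved.
sources: Ayoub2014, HuberMullerStachPeriods2017, arXiv:1105.0865, AyoubRelKZRevisited, arXiv:1811.06268
PiLocalKernel := ∀ c : Literature.NumberTheory.Transcendental.KZ.FormalRep,
Literature.NumberTheory.Transcendental.KZ.eval c = 0 → ∃ N : ℕ, (of piRep)^⋆N ⋆ c ∈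
Literature.NumberTheory.Transcendental.KZ.relations. This is the half of S reachable by torsor
arguments: Grothendieck's period conjecture gives injectivity of P̃ = P̃^eff[(2πi)⁻¹] → ℂ (route
Grothendieck, 0279), and a transfer of Nori/cohomological relators into KZ.relations (route
NoriTransfer, 0194/0198) then yields (2πi)^{2N}·c = (−4π²)^N·c ∈ relations WITHOUT needing
injectivity of P̃^eff → P̃; Ayoub's rigid-analytic computation of the Betti–de Rham torsor
(Ayoub2015 §3.6, AyoubRelKZRevisited Thm 1.11) is the model argument and works precisely after
inverting 2πi. Open (≈ GPC-strength); filed so that provers/refuters see the effective/localised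
distinction explicitly and so that a proof of #2′ collapses the problem to this item.
[needs_definition: KZ.prodRep / piRep / PiLocalKernel (def request this session); sources:
AyoubRelKZRevisited, Ayoub2015, HuberMullerStach2017] -/
@[route_item "route-KontsevichZagierPeriods-AyoubSpecialisation"]
def AyoubPiLocalKernel : Prop :=
  ∀ (P : ∀ n : ℕ, Literature.NumberTheory.Transcendental.KZ.IntegralRep n → Literature.NumberTheory.Transcendental.KZ.IntegralRep (n + 2)), (∀ (n : ℕ) (r : Literature.NumberTheory.Transcendental.KZ.IntegralRep n), (P n r).domain = {z : Fin (n + 2) → ℝ | z 0 ^ 2 + z 1 ^ 2 ≤ 1 ∧ (fun i : Fin n => z i.succ.succ) ∈ r.domain} ∧ (P n r).integrand = fun z => r.integrand (fun i : Fin n => z i.succ.succ)) → ∀ c : Literature.NumberTheory.Transcendental.KZ.FormalRep, Literature.NumberTheory.Transcendental.KZ.eval c = 0 → ∃ N : ℕ, (⇑(FreeAbelianGroup.lift (fun s : (Σ n, Literature.NumberTheory.Transcendental.KZ.IntegralRep n) => Literature.NumberTheory.Transcendental.KZ.of (P s.1 s.2))))^[N] c ∈ Literature.NumberTheory.Tr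anscendental.KZ.relations

-- item stmt-KontsevichZagierPeriods-0360 · support · rank 0 · open · by planner — informal only, no Lean statement yet:
--   X := Lifting ∧ RelativeTransfer, with Ayoub's theorem (relations among relative periods = obvious
--   relations; Ann. of Math. 181 (2015) Thm 1.3/4.25, surveyed in Ayoub2014) as a named-fact hypothesis.
--   Lifting: ∀ c ∈ ker Literature.NumberTheory.Transcendental.KZ.eval, ∃ C ∈ ker Ev_rel with sp(C) − c ∈
--   KZ.relations, where 𝒫_rel = Laurent series in ϖ with coefficients ∫_{[0,1]ⁿ} F, F ∈ 𝒪_alg(𝔻̄ⁿ)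
--   (algebraic over ℚ̄(z), holomorphic near the closed polydisc), sp = specialisation at an algebraic
--   value of ϖ / constant term. RelativeTransfer: sp maps each obvious relation (linearity; F ↦ F∘(cube
--   automor

/-- item stmt-KontsevichZagierPeriods-0197 · support · rank 1 · closed · proved by Summit.KontsevichZagierPeriods.KernelForm.kernel_implies_statement (prover) · by planner
sources: KontsevichZagier2001, HuberMullerStachPeriods2017
Provable now, 3 lines: r.value = r'.value ⇒ eval (of r − of r') = 0 (map_sub, eval_of) ⇒ of r − of
r' ∈ relations. Every structural route (Nori, Grothendieck, ExpConservative) lands in the kernel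
form; this item is the shared last step. [elaborates: yes: _survey/SketchA.lean; sources:
KontsevichZagier2001, HuberMullerStach2017] -/
@[route_item "route-KontsevichZagierPeriods-AyoubSpecialisation"]
def KernelImpliesStatement : Prop :=
  (∀ c : Literature.NumberTheory.Transcendental.KZ.FormalRep, Literature.NumberTheory.Transcendental.KZ.eval c = 0 → c ∈ Literature.NumberTheory.Transcendental.KZ.relations) → KontsevichZagierPeriods

-- `KernelImpliesStatement` holds: proved by `Summit.KontsevichZagierPeriods.KernelForm.kernel_implies_statement` (its module imports this route file, so no `_holds` link can be stated here).

-- item stmt-KontsevichZagierPeriods-0362 · support · rank 2 · open · by planner — informal only, no Lean statement yet: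
--   Open core (Ayoub notes the absolute analogue of his theorem is equivalent to the Kontsevich–Zagier
--   conjecture). Concretely: given rational reps r, r' with equal value, deform both into algebraic
--   families over a disc (insert a parameter ϖ into domains/integrands) whose value functions agree
--   identically in ϖ — equality of Laurent expansions, not just at one point. Textbook instance:
--   Legendre's relation proved by d/dk (Grothendieck #5). First test to file on expansion: does every
--   pair of equal-valued 1-dim rational reps (LowDimension #2 regime) admit such a common deformation?
--   (Baker's theorem su

-- item stmt-KontsevichZagierPeriods-0363 · support · rank 3 · open · by planner — informal only, no Lean statement yet:
--   Provable in principle and close to the H21 shapes: domains are cubes [0,1]ⁿ (no triangulation),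
--   Ayoub's Stokes rule is ∂F/∂z_n integrated in the last coordinate = newtonLeibnizRel with a = 0, b =
--   1, F algebraic (hence ℚ̄-, so ℚ-semialgebraic in more variables? — CHECK: real and imaginary parts
--   of an algebraic holomorphic F on the real cube are ℚ-semialgebraic functions of the real
--   coordinates: yes, graphs are definable by the minimal polynomial over ℚ(z) split into re/im), his
--   change of variables are algebraic automorphisms of the cube (changeOfVariablesRel), products are
--   product domains. Issu

/-- item stmt-KontsevichZagierPeriods-0542 · support · rank 4 · open · by planner
sources: HuberWustholz2022, KontsevichZagier2001, AyoubRelKZRevisited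
¬PiCancellation: ∃ c : Literature.NumberTheory.Transcendental.KZ.FormalRep, (of piRep) ⋆ c ∈
Literature.NumberTheory.Transcendental.KZ.relations ∧ c ∉
Literature.NumberTheory.Transcendental.KZ.relations. If proved, eval c = 0 (since π · eval c =
eval(piRep ⋆ c) = 0 by relations ≤ ker eval, fact
Literature.NumberTheory.Transcendental.KZ.relations_le_ker_eval) while c ∉ relations, so
KZKernelConjecture fails and, via the facts
Literature.NumberTheory.Transcendental.KZ.exists_isRational_equivalent /
Literature.NumberTheory.Transcendental.KZ.exists_integralRep_sub (see Neg route 0310),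
¬KontsevichZagierPeriods. Candidate mechanism suggested by the literature: relations that are only
reachable through an auxiliary factor of 2πi (effective period MONOID vs motivic Galois GROUP:
AyoubRelKZRevisited Rem 1.3; HuberMullerStach2017 §13.1). Where to look: identities classically
proved by squaring/multiplying by π and dividing back, e.g. Euler's ζ(2) = π²/6 via (∫∫ dxdy/(1−xy))
against disc ⋆ disc, or Legendre's relation (Grothendieck 0280) whose right side is π/2: is
[KE′+K′E−KK′] ∼ [π/2] reachable only after ⋆[π]? No candidate c is claimed; this is an open bet
filed so the negative side is st -/
@[route_item "route-KontsevichZagierPeriods-AyoubSpecialisation"]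
def AyoubNotPiCancellation : Prop :=
  ¬ (∀ (P : ∀ n : ℕ, Literature.NumberTheory.Transcendental.KZ.IntegralRep n → Literature.NumberTheory.Transcendental.KZ.IntegralRep (n + 2)), (∀ (n : ℕ) (r : Literature.NumberTheory.Transcendental.KZ.IntegralRep n), (P n r).domain = {z : Fin (n + 2) → ℝ | z 0 ^ 2 + z 1 ^ 2 ≤ 1 ∧ (fun i : Fin n => z i.succ.succ) ∈ r.domain} ∧ (P n r).integrand = fun z => r.integrand (fun i : Fin n => z i.succ.succ)) → ∀ c : Literature.NumberTheory.Transcendental.KZ.FormalRep, FreeAbelianGroup.lift (fun s : (Σ n, Literature.NumberTheory.Transcendental.KZ.IntegralRep n) => Literature.NumberTheory.Transcendental.KZ.of (P s.1 s.2)) c ∈ Literature.NumberTheory.Transcendental.KZ.relations → c ∈ Literature.NumberTheory.Transcendental.KZ.relations)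

/-- item stmt-KontsevichZagierPeriods-0543 · support · rank 5 · closed · proved by Summit.KontsevichZagierPeriods.KontsevichZagierPeriods.AyoubSpecialisationCalibration.ayoubRelACubeCalibration_proof @ c5182d656530 (prover) · by planner
sources: AyoubRelKZRevisited, Ayoub2014, KontsevichZagier2001
CALIBRATION (provable in principle; no transcendence input; trigger (e′): p3107 accepted,
Literature/NumberTheory/Transcendental/AyoubRelative.lean in tree with named fact
Literature.NumberTheory.Transcendental.AyoubRel.ayoub_relativeKZ_revisited = AyoubRelKZRevisited Thm
1.7). Ayoub's generator of type (a), ∂G/∂zᵢ − G|_{zᵢ=1} + G|_{zᵢ=0}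
(Literature.NumberTheory.Transcendental.AyoubRel.relA), t-free, after specialising ϖ ↦ ϖ₀ (relA acts
coefficientwise, so it commutes with specialisation; in the convergence range the sum is a Nash = C¹
ℚ-semialgebraic function G on an open U ⊇ [0,1]^m) is ONE integrand on the m-cube with integral 0 by
Stokes. CLAIM: the H21 4-move calculus derives [r] ∈ KZ.relations for EVERY coordinate i : Fin m,
not only Fin.last. Expected derivation: changeOfVariablesRel with the coordinate transposition (i
last) (linear, |det| = 1, cube ↦ cube) + newtonLeibnizRel over the (m−1)-cube with a = 0, b = 1,
primitive G∘swap + re-inflation of the two restriction terms G(update x i c), c ∈ {0,1}, from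
dimension m−1 back to the m-cube via newtonLeibnizRel with primitive z_last · G(update z i c) (∫₀¹
dz = 1) + integrandAddRel to split/merge the three summands (each summ -/
@[route_item "route-KontsevichZagierPeriods-AyoubSpecialisation"]
def AyoubRelACubeCalibration : Prop :=
  (∀ (n : ℕ) (s : Set (Fin n → ℝ)) (f g : (Fin n → ℝ) → ℝ), Literature.NumberTheory.Transcendental.IsSemialgebraicFunOn.add (k := ℚ) (s := s) (f := f) (g := g)) → (∀ (n : ℕ) (s : Set (Fin n → ℝ)) (f g : (Fin n → ℝ) → ℝ), Literature.NumberTheory.Transcendental.IsSemialgebraicFunOn.mul (k := ℚ) (s := s) (f := f) (g := g)) → ∀ (m : ℕ) (i : Fin m) (G : (Fin m → ℝ) → ℝ) (U : Set (Fin m → ℝ)), IsOpen U → Set.pi Set.univ (fun _ => Set.Icc (0:ℝ) 1) ⊆ U → Literature.NumberTheory.Transcendental.IsSemialgebraicFunOn ℚ U G → ContDiffOn ℝ 1 G U → ∀ (r : Literature.NumberTheory.Transcendental.KZ.IntegralRep m), r.domain = Set.pi Set.univ (fun _ => Set.Icc (0:ℝ) 1) → (∀ x ∈ r.domain, r.integrand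 x = fderiv ℝ G x (Pi.single i 1) - G (Function.update x i 1) + G (Function.update x i 0)) → Literature.NumberTheory.Transcendental.KZ.of r ∈ Literature.NumberTheory.Transcendental.KZ.relations

-- `AyoubRelACubeCalibration` holds: proved by `Summit.KontsevichZagierPeriods.KontsevichZagierPeriods.AyoubSpecialisationCalibration.ayoubRelACubeCalibration_proof` @ c5182d656530 (its module imports this route file, so no `_holds` link can be stated here).

/-- item stmt-KontsevichZagierPeriods-10941 · support · rank 9 · closed · proved by Summit.KontsevichZagierPeriods.KatzTower.discPadding_proof @ 13bc43be04e8 (prover) · by planner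
sources: KontsevichZagier2001, BCR1998
[support] the pinned product exists: a family P n r : IntegralRep (n+2) with domain {z | z₀² + z₁² ≤
1 ∧ (z₂,…,z_{n+1}) ∈ r.domain} and integrand z ↦ r.integrand (z₂,…,z_{n+1}) — i.e. [π] ⋆ r;
construction = transport of `Literature.NumberTheory.Transcendental.KZ.piRep.prod r : IntegralRep (2
+ n)` along Fin (2+n) ≃ Fin (n+2) (semialgebraicity of domain/integrand by
`IsSemialgebraic.preimage_aeval` under the coordinate relabelling, no Tarski–Seidenberg;
integrability by `KZ.IntegralRep.integrableOn_prodFun` and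
`MeasureTheory.volume_measurePreserving_piCongrLeft`), or directly by Tonelli. Index bookkeeping
only; it makes the ∀-pinned-P cruxes non-vacuous and is a hypothesis of `closes`. [difficulty:
provable-now]; sources: KontsevichZagier2001 §4.1, BCR1998 Prop. 2.2.6 -/
@[route_item "route-KontsevichZagierPeriods-AyoubSpecialisation"]
def PiProductRep : Prop :=
  ∃ (P : ∀ n : ℕ, Literature.NumberTheory.Transcendental.KZ.IntegralRep n → Literature.NumberTheory.Transcendental.KZ.IntegralRep (n + 2)), ∀ (n : ℕ) (r : Literature.NumberTheory.Transcendental.KZ.IntegralRep n), (P n r).domain = {z : Fin (n + 2) → ℝ | z 0 ^ 2 + z 1 ^ 2 ≤ 1 ∧ (fun i : Fin n => z i.succ.succ) ∈ r.domain} ∧ (P n r).integrand = fun z => r.integrand (fun i : Fin n => z i.succ.succ)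

-- `PiProductRep` holds: proved by `Summit.KontsevichZagierPeriods.KatzTower.discPadding_proof` @ 13bc43be04e8 (its module imports this route file, so no `_holds` link can be stated here).

/-- item stmt-KontsevichZagierPeriods-14210 · support · rank 9 · closed · proved by Summit.KontsevichZagierPeriods.AyoubSpecialisation.targetGlue_proof @ 649579ff6543 (prover) · by planner
[support] glue to the rank-0 target (route-choice repair 2026-08-16, gate shape
route.target-unreachable, option (a)): the pinned product plus the two cruxes give the bundled
target — PiProductRep → AyoubPiCancellation → AyoubPiLocalKernel → AyoubThesisV2. Pure logic,
provable now: `intro hP h₂ h₃; obtain ⟨P, hPin⟩ := hP; exact ⟨P, hPin, h₃ P hPin, h₂ P hPin⟩`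
(planner Sketch.lean rc 0, 0 sorries, axioms propext/Classical.choice/Quot.sound). It gives the
target an item that concludes it BY NAME and records its logical position: modulo PiProductRep the
target is equivalent to the conjunction consumed by the deciding theorem `closes` (converse:
AyoubThesisV2 → PiProductRep and AyoubThesisV2 → the Statement, same script as `closes`, also
checked in Sketch.lean). Carries no mathematical risk and changes nothing in `closes`. [deps:
PiProductRep, AyoubPiCancellation, AyoubPiLocalKernel] [difficulty: provable-now]; sources:
KontsevichZagier2001 §4.1, HuberMullerStachPeriods2017 §13.1 -/
@[route_item "route-KontsevichZagierPeriods-AyoubSpecialisation"]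
def TargetGlue : Prop :=
  PiProductRep → AyoubPiCancellation → AyoubPiLocalKernel → AyoubThesisV2

-- `TargetGlue` holds: proved by `Summit.KontsevichZagierPeriods.AyoubSpecialisation.targetGlue_proof` @ 649579ff6543 (its module imports this route file, so no `_holds` link can be stated here).

/-- item stmt-KontsevichZagierPeriods-0361 · assembly · rank 1 · closed · proved by Summit.KontsevichZagierPeriods.AyoubSpecialisation.assembly_proof @ 085a38a03231 (prover) · by planner
c ∈ ker eval ⇒ lift C ∈ ker Ev_rel (Lifting) ⇒ C ∈ obvious relations (Ayoub fact) ⇒ sp C ∈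
KZ.relations (RelativeTransfer, additivity of sp) ⇒ c ∈ KZ.relations ⇒ KZKernelConjecture ⇒
statement via stmt-KontsevichZagierPeriods-0197. Informal until AyoubRelativePeriods exists.
[needs_definition: AyoubRelativePeriods; sources: Ayoub2014] -/
@[route_item "route-KontsevichZagierPeriods-AyoubSpecialisation"]
def Assembly : Prop :=
  PiProductRep → AyoubPiCancellation → AyoubPiLocalKernel → KontsevichZagierPeriods

-- `Assembly` holds: proved by `Summit.KontsevichZagierPeriods.AyoubSpecialisation.assembly_proof` @ 085a38a03231 (its module imports this route file, so no `_holds` link can be stated here).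

-- records of items no longer active in this route (dropped / restated):
-- earlier Assembly2 (stmt-KontsevichZagierPeriods-0539, dropped 2026-08-16T14:43:05Z): moot by None — (∃ (P : ∀ n : ℕ, Literature.NumberTheory.Transcendental.KZ.IntegralRep n → Literature.NumberTheory.Transcendental.KZ.IntegralRep (n + 2)), (∀ (n : ℕ) (r : Literature.NumberTheory.Transcendental.KZ.IntegralRep n), (P n r).domain = {z : Fin (n + 2) → ℝ | z 0 ^ 2 + z 1 ^ 2 ≤ 1 ∧ (fun i : Fin n => z i.s

/-! D-0027 §2.1 — DECIDING THEOREM (planner-authored via `route open/edit --closes-file`; by planner-rbadge-KontsevichZagierPeriods-AyoubSp-8fc2808f-g3-0 2026-08-16T06:08:55Z):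
its hypotheses are this route's items and its conclusion the sub-problem Statement (glue_lint), and it elaborates with this file. -/

@[closes "route-KontsevichZagierPeriods-AyoubSpecialisation"] theorem closes (h₂ : AyoubPiCancellation) (h₃ : AyoubPiLocalKernel) :
    KontsevichZagierPeriods := by
  -- (1) The pinned product `P n r = [π] ⋆ r : IntegralRep (n + 2)` EXISTS (support item
  -- `PiProductRep`, discharged inline so that the deciding theorem assumes the two cruxes only;
  -- crux-only ruling 2026-08-16). Tonelli step: integrability survives prefixing one bounded
  -- coordinate (split off coordinate `0` with `MeasurableEquiv.piFinSuccAbove`, volume-preserving).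
  have step : ∀ (m : ℕ) (S : Set (Fin m → ℝ)) (g : (Fin m → ℝ) → ℝ), IntegrableOn g S →
      IntegrableOn (fun z : Fin (m + 1) → ℝ => g (fun i => z i.succ))
        {z : Fin (m + 1) → ℝ | z 0 ∈ Icc (-1 : ℝ) 1 ∧ (fun i => z i.succ) ∈ S} := by
    intro m S g hg
    set e := MeasurableEquiv.piFinSuccAbove (fun _ : Fin (m + 1) => ℝ) 0 with he_def
    have he : MeasurePreserving e volume volume :=
      volume_preserving_piFinSuccAbove (fun _ : Fin (m + 1) => ℝ) 0
    have happly : ∀ z : Fin (m + 1) → ℝ, e z = (z 0, fun i => z i.succ) := fun z => rfl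
    have hc : IntegrableOn (fun _ : ℝ => (1 : ℝ)) (Icc (-1 : ℝ) 1) :=
      integrableOn_const measure_Icc_lt_top.ne
    have hprod : IntegrableOn (fun p : ℝ × (Fin m → ℝ) => (fun _ : ℝ => (1 : ℝ)) p.1 * g p.2)
        (Icc (-1 : ℝ) 1 ×ˢ S) := by
      rw [IntegrableOn, Measure.volume_eq_prod, ← Measure.prod_restrict]
      exact hc.mul_prod hg
    have h2 := (he.integrableOn_comp_preimage e.measurableEmbedding).mpr hprod
    have hfun : ((fun p : ℝ × (Fin m → ℝ) => (fun _ : ℝ => (1 : ℝ)) p.1 * g p.2) ∘ e) =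
        fun z => g (fun i => z i.succ) := by
      funext z
      simp [Function.comp, happly]
    have hset : e ⁻¹' (Icc (-1 : ℝ) 1 ×ˢ S) =
        {z : Fin (m + 1) → ℝ | z 0 ∈ Icc (-1 : ℝ) 1 ∧ (fun i => z i.succ) ∈ S} := by
      ext z
      simp [happly]
    rw [hfun, hset] at h2
    exact h2
  have key : ∀ (n : ℕ) (r : Literature.NumberTheory.Transcendental.KZ.IntegralRep n),
      ∃ q : Literature.NumberTheory.Transcendental.KZ.IntegralRep (n + 2),
        q.domain = {z : Fin (n + 2) → ℝ | z 0 ^ 2 + z 1 ^ 2 ≤ 1 ∧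
            (fun i : Fin n => z i.succ.succ) ∈ r.domain} ∧
        q.integrand = fun z => r.integrand (fun i : Fin n => z i.succ.succ) := by
    intro n r
    -- the domain `disc × σ` is ℚ-semialgebraic: a polynomial inequality meets a coordinate preimage
    have hD : Literature.ModelTheory.ExponentialFields.IsSemialgebraic ℚ
        {z : Fin (n + 2) → ℝ | z 0 ^ 2 + z 1 ^ 2 ≤ 1 ∧
            (fun i : Fin n => z i.succ.succ) ∈ r.domain} := by
      have h1 : Literature.ModelTheory.ExponentialFields.IsSemialgebraic ℚ
          {z : Fin (n + 2) → ℝ | z 0 ^ 2 + z 1 ^ 2 ≤ 1} := by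
        have := Literature.ModelTheory.ExponentialFields.isSemialgebraic_setOf_eval_le
          (k := ℚ) (R := ℝ) (MvPolynomial.X 0 ^ 2 + MvPolynomial.X 1 ^ 2 : MvPolynomial (Fin (n + 2)) ℚ) 1
        simpa using this
      have h2 := r.isSemialgebraic_domain.preimage_comp (fun i : Fin n => i.succ.succ)
      have hset : {z : Fin (n + 2) → ℝ | z 0 ^ 2 + z 1 ^ 2 ≤ 1 ∧
            (fun i : Fin n => z i.succ.succ) ∈ r.domain} =
          {z : Fin (n + 2) → ℝ | z 0 ^ 2 + z 1 ^ 2 ≤ 1} ∩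
            ((fun x : Fin (n + 2) → ℝ => x ∘ (fun i : Fin n => i.succ.succ)) ⁻¹' r.domain) := by
        ext z
        simp [Function.comp_def]
      rw [hset]
      exact h1.inter h2
    -- the integrand `z ↦ f (z₂, …, z_{n+1})` is ℚ-semialgebraic on it: coordinate preimage of the
    -- graph of `f`, cut down to the cylinder (no Tarski–Seidenberg)
    have hF : Literature.NumberTheory.Transcendental.IsSemialgebraicFunOn ℚ
        {z : Fin (n + 2) → ℝ | z 0 ^ 2 + z 1 ^ 2 ≤ 1 ∧
            (fun i : Fin n => z i.succ.succ) ∈ r.domain}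
        (fun z => r.integrand (fun i : Fin n => z i.succ.succ)) := by
      rw [Literature.NumberTheory.Transcendental.isSemialgebraicFunOn_iff]
      let ρ : Fin (n + 1) → Fin (n + 2 + 1) :=
        Fin.lastCases (Fin.last (n + 2)) fun i => Fin.castSucc i.succ.succ
      have hΓ := (Literature.NumberTheory.Transcendental.isSemialgebraicFunOn_iff.mp
        r.isSemialgebraicFunOn_integrand).preimage_comp ρ
      convert hD.setOf_init_mem.inter hΓ using 1
      have hinit : ∀ w : Fin (n + 2 + 1) → ℝ,
          Fin.init (w ∘ ρ) = fun i : Fin n => Fin.init w i.succ.succ := by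
        intro w; ext i; simp [Fin.init, ρ]
      have hlast : ∀ w : Fin (n + 2 + 1) → ℝ, (w ∘ ρ) (Fin.last n) = w (Fin.last (n + 2)) := by
        intro w; simp [ρ]
      ext w
      simp only [mem_setOf_eq, mem_inter_iff, mem_preimage, hinit, hlast]
      tauto
    -- absolute convergence: two Tonelli steps, then shrink the box `[-1,1]²` to the disc
    have hI : IntegrableOn (fun z : Fin (n + 2) → ℝ => r.integrand (fun i : Fin n => z i.succ.succ))
        {z : Fin (n + 2) → ℝ | z 0 ^ 2 + z 1 ^ 2 ≤ 1 ∧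
            (fun i : Fin n => z i.succ.succ) ∈ r.domain} := by
      have h := step (n + 1) _ _ (step n r.domain r.integrand r.integrableOn)
      refine h.mono_set ?_
      intro z hz
      simp only [mem_setOf_eq] at hz ⊢
      obtain ⟨hdisc, hdom⟩ := hz
      refine ⟨?_, ?_, ?_⟩
      · constructor <;> nlinarith [sq_nonneg (z 0 + 1), sq_nonneg (z 0 - 1), sq_nonneg (z 1)]
      · simp only [Fin.succ_zero_eq_one]
        constructor <;> nlinarith [sq_nonneg (z 1 + 1), sq_nonneg (z 1 - 1), sq_nonneg (z 0)]
      · simpa using hdom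
    exact ⟨⟨_, _, hD, hF, hI⟩, rfl, rfl⟩
  choose P hPin using key
  -- (2) π-peeling: PiLocalKernel gives `[π]^{⋆N} ⋆ c ∈ relations`, PiCancellation removes one `[π]`
  -- at a time (left-nested iterates), so `ker eval ⊆ relations` (stated by its definiens).
  have hS : ∀ c : Literature.NumberTheory.Transcendental.KZ.FormalRep,
      Literature.NumberTheory.Transcendental.KZ.eval c = 0 →
        c ∈ Literature.NumberTheory.Transcendental.KZ.relations := by
    intro c hc
    obtain ⟨N, hN⟩ := h₃ P hPin c hc
    induction N with
    | zero => simpa using hN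
    | succ N ih =>
      exact ih (h₂ P hPin _ (by simpa only [Function.iterate_succ_apply'] using hN))
  -- (3) the KZ-literal statement: equal values ⇒ `[r] − [r'] ∈ ker eval = relations`.
  intro n m r r' _ _ hv
  apply hS
  simp [Literature.NumberTheory.Transcendental.KZ.eval_of, hv]

end Summit.KontsevichZagierPeriods.KontsevichZagierPeriods.Theses.AyoubSpecialisation
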